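import Mathlib
import Literature.Analysis.FluidPDE.Tao2016AveragedNS.BoundedEternalSolutions
import Summits.NavierStokesRegularity.NavierStokesRegularity.Theorems.TaoLadderRungTwoBreakNoSurvivingEternalViscBddOneWakeDyadicClassical
import Summits.NavierStokesRegularity.NavierStokesRegularity.Theorems.TaoLadderRungTwoBreakNoSurvivingEternalViscBddOneWakeDyadicDSSOvershootFloor

/-!
# Crux `TaoLadderRungTwoBreak.NoSurvivingEternalViscBddOne` (stmt-NavierStokesRegularity-20419) / ⟨20205⟩ `NoSurvivingDSSOne`, DYADIC
# MEMBER, BY NAME ON THE TREE'S OBJECTS: every admissible single-profile DSS wave of `dyadicTable` that is (S₁)-surviving OVERSHOOTS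
# on every lit shell, and every sub-unitary one obeys the exact OVERSHOOT FLOOR `sup V_n ≥ v_n(Λ² − κ√κ)/(2(Λ² − κ²))`, `κ = e^{T}`

MODEL lattice ODEs only (Tao 2016 §1.2/§4/§6.4; the tree's `IsDSSWave ε₀ dyadicTable π T Φ` with ONE profile, `dssEmbed`, and the
critical variable `V_n(t) = (−t)⁻¹(W_n(−log(−t)))₀` of `…WakeDyadicClassical`); nothing in this file is a statement about the
Navier–Stokes equations, and no stub, crux, rung or summit is proved by it (`--supports stmt-NavierStokesRegularity-20419`).  DEF-FREE.
This file only DISCHARGES, on the tree's objects, the standing hypotheses of the hand's abstract files (`…DSSTerminalDrift`,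
`…LifetimeFeedDrain`, `…EnergyFluxIdentity`, `…DSSOvershootFloor`):

* §1 (any admissible inviscid eternal solution of the dyadic member) `crit_abs_le` (each critical shell is bounded on `t < 0`),
  `crit_tendsto_atBot` (born at rest), `crit_integrableOn_sq` / `crit_integrableOn_mul` / `crit_integrableOn_flux` (lifetime feed,
  drain and flux are integrable) — from the tree's dictionary (`dyadic_crit_action`, `dyadic_crit_bdd`, `dyadic_classical_hyp_nonneg`).
* §2 (single-profile DSS waves) `crit_dss` — the critical variable of `dssEmbed π T Φ r₀` is a period-one DSS solution with `κ = e^{T}`;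
  **`dssWave_terminal_overshoot`** — if `Surviving 1 ε₀ T`, every shell with non-zero terminal value approaches it strictly from above;
  **`dssWave_overshoot_floor`** — if the wave is sub-unitary (`dssMu ε₀ T < 1`, e.g. surviving), every bound `S ≥ V_n` on `t < 0` obeys
  `(r_n)₀ · (Λ² − e^{T}√(e^{T}))/(2(Λ² − e^{2T})) ≤ S` — with the reading of `…DSSOvershootFloor`: forced overshoot by a factor `> 1` as
  soon as `2e^{2T} − e^{3T/2} > Λ²` (`θ > 4/5` as the base tends to one), unbounded as `e^{T} → Λ`.

HONEST LABEL: plumbing (integrability and limits) on top of the hand's identity files and the tree's dictionary; W1-dyadic, (ρ0),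
⟨20419⟩, ⟨20205⟩ and every NS statement remain OPEN; rung 0.
-/

-- the summit and its single sub-problem share the name (CONVENTIONS §1)
set_option linter.dupNamespace false

namespace Summit.NavierStokesRegularity.NavierStokesRegularity.Theorems.NoSurvivingEternalViscBddOne.DSSFrontOvershoot

open Filter Topology Set MeasureTheory
open Literature.Analysis.FluidPDE.TaoCascade
open Summit.NavierStokesRegularity.NavierStokesRegularity.Theorems.NoSurvivingEternalViscBddOne
open Summit.NavierStokesRegularity.NavierStokesRegularity.Theorems.NoSurvivingEternalViscBddOne.WakeCriterion
  (dyadic_crit_hasDerivAt dyadic_crit_action dyadic_crit_bdd dyadic_crit_tendsto exists_terminalProfile_fun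
    dyadic_classical_hyp_nonneg)

variable {ε₀ : ℝ} {W : ℤ → ℝ → Em 4}

/-! ## §1 Standing hypotheses for admissible eternal solutions of the dyadic member -/

/-- Each critical shell of an admissible inviscid eternal solution of the dyadic member is bounded on `t < 0`
(type-I bound far from `0`, the forward clause near `0`). [cite: Tao2016AveragedNS, §6.4; tree dictionary] -/
theorem crit_abs_le (hε : 0 < ε₀) (hW : IsEternal ε₀ dyadicTable W) (n : ℤ) :
    ∃ K : ℝ, 0 ≤ K ∧ ∀ t : ℝ, t < 0 → |(-t)⁻¹ * W n (-Real.log (-t)) 0| ≤ K := by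
  obtain ⟨-, C, hC⟩ := dyadic_classical_hyp_nonneg hε hW
  obtain ⟨t₀, ht₀, P, hP⟩ := dyadic_crit_bdd hε hW n
  have hC0 : 0 ≤ C := by
    have h := hC n (-1) (by norm_num)
    rw [neg_neg, div_one] at h
    exact (abs_nonneg _).trans h
  have hP0 : 0 ≤ P := (abs_nonneg _).trans (hP t₀ le_rfl ht₀)
  refine ⟨max P (C / (-t₀)), le_max_of_le_left hP0, fun t ht => ?_⟩
  rcases le_or_gt t₀ t with h | h
  · exact (hP t h ht).trans (le_max_left _ _)
  · refine (hC n t ht).trans ((div_le_div_of_nonneg_left hC0 (by linarith) (by linarith)).trans (le_max_right _ _))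

/-- The critical shells are continuous on `t < 0`. [elementary] -/
theorem crit_continuousOn (hW : IsEternal ε₀ dyadicTable W) (n : ℤ) :
    ContinuousOn (fun s : ℝ => (-s)⁻¹ * W n (-Real.log (-s)) 0) (Iio 0) :=
  fun _ ht => (dyadic_crit_hasDerivAt hW n ht).continuousAt.continuousWithinAt

/-- **Born at rest**: `V_n(t) → 0` as `t → −∞` (type-I bound `|V_n| ≤ C/(−t)`). [cite: Tao2016AveragedNS, §6.4; tree dictionary] -/
theorem crit_tendsto_atBot (hε : 0 < ε₀) (hW : IsEternal ε₀ dyadicTable W) (n : ℤ) :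
    Tendsto (fun s : ℝ => (-s)⁻¹ * W n (-Real.log (-s)) 0) atBot (𝓝 0) := by
  obtain ⟨-, C, hC⟩ := dyadic_classical_hyp_nonneg hε hW
  have hg : Tendsto (fun s : ℝ => C / (-s)) atBot (𝓝 0) := by
    have h1 : Tendsto (fun s : ℝ => (-s)⁻¹) atBot (𝓝 0) := tendsto_inv_atTop_zero.comp tendsto_neg_atBot_atTop
    simpa [div_eq_mul_inv] using h1.const_mul C
  refine squeeze_zero_norm' ?_ hg
  filter_upwards [eventually_lt_atBot (0 : ℝ)] with s hs
  rw [Real.norm_eq_abs]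
  exact hC n s hs

/-- A continuous function dominated by `K·|V_n|` on `t < 0` is integrable on `(−∞, 0]`. [elementary] -/
theorem integrableOn_of_le_mul_abs (hε : 0 < ε₀) (hW : IsEternal ε₀ dyadicTable W) (n : ℤ) {f : ℝ → ℝ}
    (hf : ContinuousOn f (Iio 0)) {K : ℝ}
    (hle : ∀ t : ℝ, t < 0 → |f t| ≤ K * |(-t)⁻¹ * W n (-Real.log (-t)) 0|) :
    IntegrableOn f (Iic 0) := by
  obtain ⟨M, hM⟩ := dyadic_crit_action hε hW
  have hint : IntegrableOn (fun t : ℝ => K * |(-t)⁻¹ * W n (-Real.log (-t)) 0|) (Iio 0) := (hM n).1.const_mul K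
  have h : IntegrableOn f (Iio 0) := by
    refine Integrable.mono' hint (hf.aestronglyMeasurable measurableSet_Iio) ?_
    exact ae_restrict_of_forall_mem measurableSet_Iio fun t ht => by
      rw [Real.norm_eq_abs]; exact hle t ht
  exact h.congr_set_ae Iio_ae_eq_Iic.symm

/-- **Lifetime feed integrable**: `∫_{(−∞,0]} V_n² < ∞`. [cite: Tao2016AveragedNS, §6.4; tree dictionary] -/
theorem crit_integrableOn_sq (hε : 0 < ε₀) (hW : IsEternal ε₀ dyadicTable W) (n : ℤ) :
    IntegrableOn (fun s : ℝ => ((-s)⁻¹ * W n (-Real.log (-s)) 0) ^ 2) (Iic 0) := by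
  obtain ⟨K, hK0, hK⟩ := crit_abs_le hε hW n
  refine integrableOn_of_le_mul_abs hε hW n ((crit_continuousOn hW n).pow 2) (K := K) fun t ht => ?_
  rw [abs_pow, pow_two]
  exact mul_le_mul_of_nonneg_right (hK t ht) (abs_nonneg _)

/-- **Lifetime drain integrable**: `∫_{(−∞,0]} V_nV_{n+1} < ∞`. [cite: Tao2016AveragedNS, §6.4; tree dictionary] -/
theorem crit_integrableOn_mul (hε : 0 < ε₀) (hW : IsEternal ε₀ dyadicTable W) (n : ℤ) :
    IntegrableOn (fun s : ℝ => ((-s)⁻¹ * W n (-Real.log (-s)) 0) * ((-s)⁻¹ * W (n + 1) (-Real.log (-s)) 0)) (Iic 0) := by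
  obtain ⟨K, hK0, hK⟩ := crit_abs_le hε hW (n + 1)
  refine integrableOn_of_le_mul_abs hε hW n ((crit_continuousOn hW n).mul (crit_continuousOn hW (n + 1))) (K := K)
    fun t ht => ?_
  rw [abs_mul, mul_comm K]
  exact mul_le_mul_of_nonneg_left (hK t ht) (abs_nonneg _)

/-- `|c·(a²b)| ≤ |c|·(KK')·|a|` when `|a| ≤ K`, `|b| ≤ K'`. [folklore] -/
theorem abs_flux_le {c a b K K' : ℝ} (ha : |a| ≤ K) (hb : |b| ≤ K') (hK : 0 ≤ K) :
    |c * (a ^ 2 * b)| ≤ |c| * (K * K') * |a| := by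
  have h1 : |a| * |b| ≤ K * K' := mul_le_mul ha hb (abs_nonneg _) hK
  have h2 : |a| * |a| * |b| ≤ K * K' * |a| := by
    calc |a| * |a| * |b| = |a| * (|a| * |b|) := by ring
      _ ≤ |a| * (K * K') := mul_le_mul_of_nonneg_left h1 (abs_nonneg _)
      _ = K * K' * |a| := by ring
  calc |c * (a ^ 2 * b)| = |c| * (|a| * |a| * |b|) := by rw [abs_mul, abs_mul, abs_pow, pow_two]
    _ ≤ |c| * (K * K' * |a|) := mul_le_mul_of_nonneg_left h2 (abs_nonneg _)
    _ = |c| * (K * K') * |a| := by ring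

/-- **Lifetime flux integrable**: `∫_{(−∞,0]} 2Λ^{-2k-1}V_k²V_{k+1} < ∞`. [cite: Tao2016AveragedNS, §6.4; tree dictionary] -/
theorem crit_integrableOn_flux (hε : 0 < ε₀) (hW : IsEternal ε₀ dyadicTable W) (k : ℤ) :
    IntegrableOn (fun s : ℝ => 2 * (((bigLam ε₀ ^ k)⁻¹) ^ 2 * (bigLam ε₀)⁻¹) *
      (((-s)⁻¹ * W k (-Real.log (-s)) 0) ^ 2 * ((-s)⁻¹ * W (k + 1) (-Real.log (-s)) 0))) (Iic 0) := by
  obtain ⟨K, hK0, hK⟩ := crit_abs_le hε hW k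
  obtain ⟨K', hK0', hK'⟩ := crit_abs_le hε hW (k + 1)
  have hcont : ContinuousOn (fun s : ℝ => 2 * (((bigLam ε₀ ^ k)⁻¹) ^ 2 * (bigLam ε₀)⁻¹) *
      (((-s)⁻¹ * W k (-Real.log (-s)) 0) ^ 2 * ((-s)⁻¹ * W (k + 1) (-Real.log (-s)) 0))) (Iio 0) :=
    continuousOn_const.mul (((crit_continuousOn hW k).pow 2).mul (crit_continuousOn hW (k + 1)))
  exact integrableOn_of_le_mul_abs hε hW k hcont
    (K := |2 * (((bigLam ε₀ ^ k)⁻¹) ^ 2 * (bigLam ε₀)⁻¹)| * (K * K'))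
    fun t ht => abs_flux_le (hK t ht) (hK' t ht) hK0

/-! ## §2 Single-profile DSS waves of the dyadic member -/

section DSS

variable {perm : Equiv.Perm (Fin 1)} {T : ℝ} {Φ : Fin 1 → ℝ → Em 4} {r₀ : Fin 1}

/-- The critical variable of a single-profile DSS wave is a period-one DSS solution with `κ = e^{T}`.
[cite: Tao2016AveragedNS, §4 Lemma 4.1 (4.8), §6.4; tree `crit_dssEmbed_scaling`] -/
theorem crit_dss (T : ℝ) (Φ : Fin 1 → ℝ → Em 4) (perm : Equiv.Perm (Fin 1)) (r₀ : Fin 1) (n : ℤ) {t : ℝ}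
    (ht : t < 0) :
    (fun (k : ℤ) (s : ℝ) => (-s)⁻¹ * (dssEmbed perm T Φ r₀ k (-Real.log (-s))) 0) (n + 1) t
      = Real.exp T * (fun (k : ℤ) (s : ℝ) => (-s)⁻¹ * (dssEmbed perm T Φ r₀ k (-Real.log (-s))) 0) n
          (Real.exp T * t) := by
  simp only
  exact DSSTerminalDrift.crit_dssEmbed_scaling perm T Φ r₀ 0 n ht

/-- `dssMu ε₀ T < 1` (sub-unitary wave) means `e^{T} < Λ`. [cell vocabulary `dssMu`, `bigLam`] -/
theorem exp_lt_bigLam_of_dssMu_lt_one (hε : 0 < ε₀) (h : dssMu ε₀ T < 1) : Real.exp T < bigLam ε₀ := by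
  have h1 : 0 < 1 + ε₀ := by linarith
  have h5 : 0 < (1 + ε₀) ^ 5 := pow_pos h1 5
  unfold dssMu at h
  rw [div_lt_one h5] at h
  have h2 : Real.exp T ^ 2 < bigLam ε₀ ^ 2 := by
    rw [bigLam_sq hε.le, ← Real.exp_nat_mul]; push_cast; simpa using h
  exact (pow_lt_pow_iff_left₀ (Real.exp_pos T).le (bigLam_pos (by linarith)).le two_ne_zero).1 h2

/-- **(S₁)-SURVIVING SINGLE-PROFILE DSS WAVES OF THE DYADIC MEMBER OVERSHOOT ON EVERY LIT SHELL.**  Let `Φ` carry an admissible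
single-profile DSS wave of `dyadicTable` with delay `T`, `Surviving 1 ε₀ T`, and let `r` be the terminal profile of the eternal solution
`W = dssEmbed π T Φ r₀` (`e^{σ}W_n(σ) → r_n`).  Then on every shell with `(r_n)₀ ≠ 0` the critical variable approaches its terminal value
strictly from above: `(r_n)₀ < (−t)⁻¹(W_n(−log(−t)))₀` for all `t < 0` close to `0`.
[cite: Tao2016AveragedNS, §1.2, §4 Lemma 4.1 (4.8) and the viscous equation before Thm. 4.2, §6.4; tree `dss_overshoot`] -/
theorem dssWave_terminal_overshoot (hε : 0 < ε₀) (hΦ : IsDSSWave ε₀ dyadicTable perm T Φ) (hS : Surviving 1 ε₀ T)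
    {r : ℤ → Em 4} (hr : ∀ k : ℤ, Tendsto (fun σ : ℝ => Real.exp σ • dssEmbed perm T Φ r₀ k σ) atTop (𝓝 (r k)))
    {n : ℤ} (hn : r n 0 ≠ 0) :
    ∀ᶠ t in 𝓝[<] (0 : ℝ), r n 0 < (-t)⁻¹ * (dssEmbed perm T Φ r₀ n (-Real.log (-t))) 0 := by
  have hW : IsEternal ε₀ dyadicTable (dssEmbed perm T Φ r₀) := hΦ.isEternal_dssEmbed r₀
  have h := DSSTerminalDrift.dss_overshoot (V := fun (k : ℤ) (s : ℝ) => (-s)⁻¹ * (dssEmbed perm T Φ r₀ k (-Real.log (-s))) 0)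
    (v := fun k => r k 0) hε (Real.exp_pos T)
    (fun k t ht => dyadic_crit_hasDerivAt hW k ht) (fun k t ht => crit_dss T Φ perm r₀ k ht)
    (fun k => dyadic_crit_tendsto hr k) (DSSTerminalDrift.bigLam_sq_lt_exp_cube_of_surviving hε hS) (n := n) hn
  exact h

/-- **THE OVERSHOOT FLOOR FOR SINGLE-PROFILE DSS WAVES OF THE DYADIC MEMBER.**  Let `Φ` carry an admissible single-profile DSS wave of
`dyadicTable` with delay `T`, sub-unitary (`dssMu ε₀ T < 1`; automatic for surviving waves), and let `r` be the terminal profile of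
`W = dssEmbed π T Φ r₀`.  Then every bound `S` of the critical shell `n` on `t < 0` satisfies, with `κ = e^{T}`,
`(r_n)₀ · (Λ² − κ√κ)/(2(Λ² − κ²)) ≤ S`.
[cite: Tao2016AveragedNS, §1.2, §4 Lemma 4.1 (4.8)–(4.10), §6.4; tree `dss_overshoot_floor`] -/
theorem dssWave_overshoot_floor (hε : 0 < ε₀) (hΦ : IsDSSWave ε₀ dyadicTable perm T Φ) (hμ : dssMu ε₀ T < 1)
    {r : ℤ → Em 4} (hr : ∀ k : ℤ, Tendsto (fun σ : ℝ => Real.exp σ • dssEmbed perm T Φ r₀ k σ) atTop (𝓝 (r k)))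
    (n : ℤ) {S : ℝ} (hS : ∀ t : ℝ, t < 0 → (-t)⁻¹ * (dssEmbed perm T Φ r₀ n (-Real.log (-t))) 0 ≤ S) :
    r n 0 * ((bigLam ε₀ ^ 2 - Real.exp T * Real.sqrt (Real.exp T)) / (2 * (bigLam ε₀ ^ 2 - Real.exp T ^ 2))) ≤ S := by
  have hW : IsEternal ε₀ dyadicTable (dssEmbed perm T Φ r₀) := hΦ.isEternal_dssEmbed r₀
  obtain ⟨hpos, -⟩ := dyadic_classical_hyp_nonneg hε hW
  exact DSSOvershootFloor.dss_overshoot_floor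
    (V := fun (k : ℤ) (s : ℝ) => (-s)⁻¹ * (dssEmbed perm T Φ r₀ k (-Real.log (-s))) 0)
    (v := fun k => r k 0)
    (P := fun (k : ℤ) (s : ℝ) => 2 * (((bigLam ε₀ ^ k)⁻¹) ^ 2 * (bigLam ε₀)⁻¹) *
      (((-s)⁻¹ * (dssEmbed perm T Φ r₀ k (-Real.log (-s))) 0) ^ 2 *
        ((-s)⁻¹ * (dssEmbed perm T Φ r₀ (k + 1) (-Real.log (-s))) 0)))
    hε (Real.exp_pos T) (exp_lt_bigLam_of_dssMu_lt_one hε hμ)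
    (fun k t ht => dyadic_crit_hasDerivAt hW k ht) hpos (fun k t ht => crit_dss T Φ perm r₀ k ht) (fun k t => rfl)
    (fun k => dyadic_crit_tendsto hr k) (fun k => crit_tendsto_atBot hε hW k) (fun k => crit_integrableOn_sq hε hW k)
    (fun k => crit_integrableOn_mul hε hW k) (fun k => crit_integrableOn_flux hε hW k) n hS

/-- **Surviving waves beyond the threshold overshoot by a definite factor.**  Under the hypotheses of `dssWave_overshoot_floor`, if
`2e^{2T} − e^{T}√(e^{T}) > Λ²` (as the base tends to one: `e^{T} ≥ Λ^θ`, `θ > 4/5`) and `(r_n)₀ > 0`, every bound `S` of shell `n` has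
`(r_n)₀ < S`.  [cite: Tao2016AveragedNS, §1.2, §4, §6.4; tree `dss_strict_overshoot`] -/
theorem dssWave_strict_overshoot (hε : 0 < ε₀) (hΦ : IsDSSWave ε₀ dyadicTable perm T Φ) (hμ : dssMu ε₀ T < 1)
    {r : ℤ → Em 4} (hr : ∀ k : ℤ, Tendsto (fun σ : ℝ => Real.exp σ • dssEmbed perm T Φ r₀ k σ) atTop (𝓝 (r k)))
    (hthr : bigLam ε₀ ^ 2 < 2 * Real.exp T ^ 2 - Real.exp T * Real.sqrt (Real.exp T))
    {n : ℤ} (hn : 0 < r n 0) {S : ℝ}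
    (hS : ∀ t : ℝ, t < 0 → (-t)⁻¹ * (dssEmbed perm T Φ r₀ n (-Real.log (-t))) 0 ≤ S) : r n 0 < S := by
  have h := dssWave_overshoot_floor hε hΦ hμ hr n hS
  have hf := DSSOvershootFloor.one_lt_overshootFactor (Real.exp_pos T) (exp_lt_bigLam_of_dssMu_lt_one hε hμ) hthr
  have : r n 0 * 1 < r n 0 * ((bigLam ε₀ ^ 2 - Real.exp T * Real.sqrt (Real.exp T)) /
      (2 * (bigLam ε₀ ^ 2 - Real.exp T ^ 2))) := mul_lt_mul_of_pos_left hf hn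
  linarith

end DSS

end Summit.NavierStokesRegularity.NavierStokesRegularity.Theorems.NoSurvivingEternalViscBddOne.DSSFrontOvershoot
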